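import Summits.KontsevichZagierPeriods.Zeta5Search.Denom.TwoTaleL25Inclusion
import Summits.KontsevichZagierPeriods.Zeta5Search.TwoTaleL25Decay
import Summits.KontsevichZagierPeriods.Zeta5Search.TwoTaleL25GrowthEnclosure
import Summits.KontsevichZagierPeriods.Zeta5Search.TwoTaleD1Measure
import HarnessLib

/-!
# RUNG L(2/5): the irrationality exponent of `ζ(2) = π²/6` is at most `5.01982` (capstone of the L(2/5) chain)

HONEST FRAMING: systematic search; no irrationality claim unless certified.  This file asserts nothing about `ζ(5)`.
It draws together, with NO hypothesis, three tree theorems of the L(2/5) programme of cell pub-zeta5 (measure-opt g0; the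
next rung `s = 2/5` of fam-measure g8's two-tale ladder `L(s)` after the D1 = L(1/3) theorem
`TwoTaleD1Measure.zetaTwo_exponent_le_D1 : ExponentLE (zetaValue 2) 5.0205`; two-tale point
`a = (32n+1, 27n+1, 22n+1, 37n+1)`, `b = (1, 5n+1, 10n+1, 64n+2)` of [Zudilin 2014, §3] = `Lad(5n, 2n)` with its Remark-5
partner):

* the rung theorem with the inclusion DISCHARGED, `Denom.TwoTaleL25Inclusion.zetaTwo_exponent_le_L25 :
  DecayL25 71.44179 → CoeffRateL25 C₁ → 0 < C₁ → C₁ ≤ 102.84495 → ExponentLE (zetaValue 2) 5.01982` — Zudilin's Lemma 7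
  digit cells for `q_n, p_n`, Lemma 8 cells at the partner transported by the ladder identity `(bmiss)`
  (`TwoTaleOmega.OmegaLadder.bmiss_Lad`, from cert-2's `OmegaBmiss`), the normaliser `D₃₇ₙ D₃₉ₙ` and the certified
  saving rate `39.27798 ≤ S ≤ 39.27811` (`Denom.TwoTaleL25Saving`), composed through the generic
  `exponentLE_of_normalisedForms`;
* the tale-1 DECAY `TwoTaleL25Line.decayL25_holds_sharp : DecayL25 71.44179` (vertical-line representation, strip shift
  to `x = ⌊127n/10⌋`, termwise line rate, and the `decide +kernel` two-point certificate `profileL25_le … ≤ −71.441797`);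
* the coefficient GROWTH `TwoTaleL25Growth.coeffRateL25_holds : CoeffRateL25 C₁starL25` with `C₁starL25_pos` and the
  kernel enclosure `C₁starL25_le : C₁starL25 ≤ 102.84495` (Whipple `q_n = −q̂_n`, one-signed binomial sum, Laplace squeeze).

RESULT: `zetaTwo_exponent_le_L25 : ExponentLE (zetaValue 2) 5.01982`, restated in Mathlib terms only as
`pi_sq_div_six_not_liouvilleWith_L25 : ∀ p > 5.01982, ¬ LiouvilleWith p (π²/6)` (via `ζ(2) = π²/6`, Mathlib
`hasSum_zeta_two`) and `pi_sq_not_liouvilleWith_L25`.  Kernel arithmetic behind the constant: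
`1 + (102.84495 + 76 − 39.27798)/(71.44179 − 76 + 39.27798) = 5.019814… ≤ 5.01982` (design value `5.01980532`).
`zetaTwo_exponent_le_L25_and_D1` records that the new constant sharpens the D1 rung (`5.01982 < 5.0205`).

READING / CAVEATS: a measure bound for the KNOWN-IRRATIONAL number `π²`, not an irrationality proof, with no bearing on
`ζ(5)`; it lies below the tree's D1 bound `5.0205`, the P15 bound `5.0499` and the printed record `5.095412` of
[Zudilin 2014, Thm 1] [cite: Zudilin2014ZetaTwo, Theorem 1]; the [Zu14] inputs are the tree's own kernel-checked
formalisations (the paper is cited for provenance); the human-readable proof must be written and refereed before prose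
claims; `5.01982` is the constant of the L(2/5) design as certified (model `5.01980532`); the ladder `L(s)` has model
infimum `5.019370` (fam-measure g8 `rung_cost.log`, near `s = 22/63`), so further rungs can move at most the fourth decimal
by `≈ 4·10⁻⁴`; the rational rungs between (`3/8`, `7/20`, …) are DESIGN only.
-/

namespace Summit.KontsevichZagierPeriods.Zeta5Search.TwoTaleL25Measure

open Literature.NumberTheory.Transcendental (zetaValue)

/-- **`μ(ζ(2)) ≤ 5.01982`**: the irrationality exponent of `ζ(2)` is at most `5.01982`, with no hypothesis —
`ExponentLE ξ κ := ∀ p, κ < p → ¬ LiouvilleWith p ξ` (`MeasureRecords`).  Rung L(2/5) of the two-tale ladder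
(see the module docstring); below the tree's D1 rung `5.0205` and the printed record `5.095412`
[cite: Zudilin2014ZetaTwo, Theorem 1]. -/
theorem zetaTwo_exponent_le_L25 : ExponentLE (zetaValue 2) 5.01982 :=
  Denom.TwoTaleL25Inclusion.zetaTwo_exponent_le_L25 TwoTaleL25Line.decayL25_holds_sharp
    TwoTaleL25Growth.coeffRateL25_holds TwoTaleL25Growth.C₁starL25_pos TwoTaleL25Growth.C₁starL25_le

/-- `μ(ζ(2)) ≤ 5.0199` (four-decimal form of the L(2/5) rung). -/
theorem zetaTwo_exponent_le_L25' : ExponentLE (zetaValue 2) 5.0199 :=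
  zetaTwo_exponent_le_L25.mono (by norm_num)

/-- **`μ(π²/6) ≤ 5.01982` in Mathlib terms only** (junk-value-free restatement): for every real `p > 5.01982`,
`π²/6` is not Liouville with exponent `p`. [cite: Zudilin2014ZetaTwo, Theorem 1] -/
theorem pi_sq_div_six_not_liouvilleWith_L25 :
    ∀ p : ℝ, (5.01982 : ℝ) < p → ¬ LiouvilleWith p (Real.pi ^ 2 / 6) := by
  intro p hp
  have h2 : zetaValue 2 = Real.pi ^ 2 / 6 := by rw [zetaValue]; exact hasSum_zeta_two.tsum_eq
  rw [← h2]
  exact zetaTwo_exponent_le_L25 p hp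

/-- `μ(π²) ≤ 5.01982` as well (`LiouvilleWith` is invariant under multiplication by a nonzero rational, Mathlib
`LiouvilleWith.mul_rat_iff`). -/
theorem pi_sq_not_liouvilleWith_L25 : ∀ p : ℝ, (5.01982 : ℝ) < p → ¬ LiouvilleWith p (Real.pi ^ 2) := by
  intro p hp h
  refine pi_sq_div_six_not_liouvilleWith_L25 p hp ?_
  have e : Real.pi ^ 2 / 6 = Real.pi ^ 2 * ((1 / 6 : ℚ) : ℝ) := by push_cast; ring
  rw [e, LiouvilleWith.mul_rat_iff (by norm_num)]
  exact h

/-- The ladder step in one line: both rungs are tree theorems and the L(2/5) constant is the smaller one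
(`5.01982 < 5.0205`; D1 = `TwoTaleD1Measure.zetaTwo_exponent_le_D1`). -/
theorem zetaTwo_exponent_le_L25_and_D1 :
    ExponentLE (zetaValue 2) 5.01982 ∧ ExponentLE (zetaValue 2) 5.0205 ∧ (5.01982 : ℝ) < 5.0205 :=
  ⟨zetaTwo_exponent_le_L25, TwoTaleD1Measure.zetaTwo_exponent_le_D1, by norm_num⟩


/-!
## Restatements over Mathlib's `riemannZeta` (append; same shape as `TwoTaleD1Measure.riemannZeta_two_re_not_liouvilleWith_D1`)

The bound `μ(ζ(2)) ≤ 5.01982` with Mathlib's `riemannZeta` in place of the tree's real series `zetaValue 2`, so that the `ζ(2)`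
form of the statement can be checked against Mathlib alone (`riemannZeta`, `Complex.re`, `LiouvilleWith`, numerals).  No new
mathematics: `Literature.NumberTheory.Transcendental.ofReal_zetaValue` (`(zetaValue k : ℂ) = riemannZeta k` for `1 < k`) and
`Complex.ofReal_re`.  HONEST FRAMING: a measure bound for the known-irrational `ζ(2) = π²/6`; nothing about `ζ(5)`.
-/

open Literature.NumberTheory.Transcendental (ofReal_zetaValue) in
/-- **`μ(ζ(2)) ≤ 5.01982` over Mathlib's `riemannZeta`**: for every real `p > 5.01982`, the real part of `riemannZeta 2`
(the real number `ζ(2) = π²/6`) is not Liouville with exponent `p`. [cite: Zudilin2014ZetaTwo, Theorem 1] -/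
theorem riemannZeta_two_re_not_liouvilleWith_L25 :
    ∀ p : ℝ, (5.01982 : ℝ) < p → ¬ LiouvilleWith p (riemannZeta 2).re := by
  intro p hp
  have h : (riemannZeta 2).re = zetaValue 2 := by
    rw [show (2 : ℂ) = ((2 : ℕ) : ℂ) by norm_num, ← ofReal_zetaValue (by norm_num), Complex.ofReal_re]
  rw [h]
  exact zetaTwo_exponent_le_L25 p hp

/-- The same without `Complex.re`: any real `x` whose complex coercion is `riemannZeta 2` (there is exactly one, `x = π²/6`)
is not Liouville with any exponent `p > 5.01982`. [cite: Zudilin2014ZetaTwo, Theorem 1] -/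
theorem not_liouvilleWith_of_ofReal_eq_riemannZeta_two_L25 :
    ∀ p : ℝ, (5.01982 : ℝ) < p → ∀ x : ℝ, (x : ℂ) = riemannZeta 2 → ¬ LiouvilleWith p x := by
  intro p hp x hx
  have e : x = (riemannZeta 2).re := by rw [← hx, Complex.ofReal_re]
  rw [e]
  exact riemannZeta_two_re_not_liouvilleWith_L25 p hp

/-!
## The literal «finitely many pairs» reading at `5.01982` (append, measure-opt g2, 2026-08-26)

For every `p > 5.01982` and every `C` there are only finitely many pairs `(m, n) ∈ ℤ × ℕ` with `0 < |π² − m/n| < C / n^p`, and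
the same for `π²/6 = ζ(2)` — as a `Set.Finite` over `ℤ × ℕ` (vocabulary `Real.pi`, `|·|`, `rpow`, numerals), plus the threshold
forms.  Derived from `pi_sq_not_liouvilleWith_L25` / `riemannZeta_two_re_not_liouvilleWith_L25` and the generic unfolding lemmas of
`TwoTaleD1Measure` (`finite_pairs_of_not_liouvilleWith`, `exists_threshold_of_not_liouvilleWith`; measure-writer g6's D1 append, same
shape at `5.0205`; the L(7/20) file carries the same at `5.0194`).  No new mathematics.  HONEST FRAMING: a measure bound for the
known-irrational `π²`; nothing about `ζ(5)`.
-/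

/-- **Finitely many pairs at exponent `5.01982`.**  For every real `p > 5.01982` and every `C`, only finitely many pairs
`(m, n) ∈ ℤ × ℕ` satisfy `0 < |π² − m/n| < C / n^p`.  From `pi_sq_not_liouvilleWith_L25` and Mathlib's definition of
`LiouvilleWith` alone (via `TwoTaleD1Measure.finite_pairs_of_not_liouvilleWith`). [cite: Zudilin2014ZetaTwo, Theorem 1] -/
theorem pi_sq_finitely_many_approximations_L25 (p : ℝ) (hp : (5.01982 : ℝ) < p) (C : ℝ) :
    Set.Finite {q : ℤ × ℕ | 0 < |Real.pi ^ 2 - (q.1 : ℝ) / q.2| ∧ |Real.pi ^ 2 - (q.1 : ℝ) / q.2| < C / (q.2 : ℝ) ^ p} :=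
  TwoTaleD1Measure.finite_pairs_of_not_liouvilleWith (by linarith) (pi_sq_not_liouvilleWith_L25 p hp) C

/-- The same for `π²/6 = ζ(2)` at exponent `5.01982`. -/
theorem pi_sq_div_six_finitely_many_approximations_L25 (p : ℝ) (hp : (5.01982 : ℝ) < p) (C : ℝ) :
    Set.Finite {q : ℤ × ℕ | 0 < |Real.pi ^ 2 / 6 - (q.1 : ℝ) / q.2| ∧
      |Real.pi ^ 2 / 6 - (q.1 : ℝ) / q.2| < C / (q.2 : ℝ) ^ p} :=
  TwoTaleD1Measure.finite_pairs_of_not_liouvilleWith (by linarith) (pi_sq_div_six_not_liouvilleWith_L25 p hp) C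

/-- **Threshold form at `5.01982`**: for `p > 5.01982` and every `C` there is `N` with `π² = m/n ∨ C/n^p ≤ |π² − m/n|` for all
`n ≥ N`, `m ∈ ℤ`. -/
theorem pi_sq_approximation_threshold_L25 (p : ℝ) (hp : (5.01982 : ℝ) < p) (C : ℝ) :
    ∃ N : ℕ, ∀ n : ℕ, N ≤ n → ∀ m : ℤ, Real.pi ^ 2 = (m : ℝ) / n ∨ C / (n : ℝ) ^ p ≤ |Real.pi ^ 2 - (m : ℝ) / n| := by
  obtain ⟨N, hN⟩ := TwoTaleD1Measure.exists_threshold_of_not_liouvilleWith (pi_sq_not_liouvilleWith_L25 p hp) C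
  exact ⟨N, fun n hn m => (em _).imp_right (hN n hn m)⟩

/-- The same threshold form over Mathlib's `riemannZeta`: for `p > 5.01982` and every `C` there is `N` with
`(riemannZeta 2).re = m/n ∨ C/n^p ≤ |(riemannZeta 2).re − m/n|` for all `n ≥ N`, `m ∈ ℤ`. -/
theorem riemannZeta_two_re_approximation_threshold_L25 (p : ℝ) (hp : (5.01982 : ℝ) < p) (C : ℝ) :
    ∃ N : ℕ, ∀ n : ℕ, N ≤ n → ∀ m : ℤ,
      (riemannZeta 2).re = (m : ℝ) / n ∨ C / (n : ℝ) ^ p ≤ |(riemannZeta 2).re - (m : ℝ) / n| := by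
  obtain ⟨N, hN⟩ :=
    TwoTaleD1Measure.exists_threshold_of_not_liouvilleWith (riemannZeta_two_re_not_liouvilleWith_L25 p hp) C
  exact ⟨N, fun n hn m => (em _).imp_right (hN n hn m)⟩

end Summit.KontsevichZagierPeriods.Zeta5Search.TwoTaleL25Measure
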